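import Mathlib
import Summits.QuantumFields.YangMills.Theorems.ConvexGribovBodyContinuumLegGivenGapCsclTorusForms
import Literature.MathematicalPhysics.QuantumFieldTheory.SpeciesTimeReflection
import HarnessLib

/-!
# `ContinuumLegGivenGap` (stmt-QuantumFields-15828), line `Sketch`, reshape 18: `stub_csclConv` — convergence of representative pairings from raw monomial data

Support file for the crux item stmt-QuantumFields-15828 (registered glue stub `stub_csclConv` of line `Sketch`, reshape 18).

At fixed lattice spacing the torus Wilson states along the odd sides `2 S_j + 1 → ∞` are made (elsewhere, by a diagonal
extraction) to converge on the countable family of RAW MONOMIAL pairings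
`∫ (∏ᵢ P(θ_{uᵢ} Θ Ũ)) (∏ᵢ P(θ_{vᵢ} τ^σ Ũ)) dμ` (`P = r.curvature.F`, `θ_u = configShift (−u)`, `Θ = cfgReflect`,
`τ^σ = configShift (−σ e₀)`, `Ũ = torusLift (2 S_j + 1) U`). This file transports that convergence to the pairings
`∫ conj 𝔛_F(Θ Ũ) · 𝔛_{G'}(τ^σ Ũ) dμ` and the means `∫ 𝔛_F(Ũ) dμ` of the lattice representatives
`𝔛_F(V) = ∑ₓ F(a x) ∏ᵢ (P(θ_{xᵢ} V) − m)` of arbitrary test functions: these are FINITE complex combinations of raw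
monomials (`∏ᵢ (Pᵢ − m) = ∑_t (−m)^{|tᶜ|} ∏_{i ∈ t} Pᵢ`, a sub-product over `t` re-indexed over `Fin |t|`), every
integrand is bounded and measurable on a probability space, so finite sums commute with the integral and limits add up.
The bookkeeping is done once in a `G`-blind abstract form (`csclConv_pairing`, `csclConv_mean`: a sequence of finite
measure spaces and two families `QA, QB` of uniformly bounded measurable real observables whose mixed monomials have
convergent integrals) and then specialised. No definitions, no facts; Mathlib + landed tree lemmas only. [folklore]
-/

noncomputable section

namespace Summit.QuantumFields.YangMills.Theorems.ContinuumLegGivenGap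

open scoped SchwartzMap ComplexConjugate
open Filter Topology MeasureTheory
open Literature.MathematicalPhysics.QuantumFieldTheory Literature.MathematicalPhysics.QuantumLattice
  Literature.MathematicalPhysics.AQFT Literature.Probability.LatticeModels

/-! ### Finite algebra: centred products are combinations of sub-monomials -/

/-- `∏ᵢ (fᵢ − c) = ∑_{t} (∏_{i ∉ t} (−c)) · ∏_{i ∈ t} fᵢ` in a commutative ring. [folklore] -/
theorem csclConv_prod_sub_const {R ι : Type*} [CommRing R] [Fintype ι] [DecidableEq ι] (f : ι → R) (c : R) :
    ∏ i, (f i - c) = ∑ t : Finset ι, (∏ _i ∈ tᶜ, (-c)) * ∏ i ∈ t, f i := by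
  have h := Fintype.prod_add f (fun _ => -c)
  simp only [← sub_eq_add_neg] at h
  rw [h]
  exact Finset.sum_congr rfl fun t _ => mul_comm _ _

/-- A product over a finset `t` is a product over `Fin |t|` (re-indexing along `t.equivFin`). [folklore] -/
theorem csclConv_prod_eq_prod_fin {M ι : Type*} [CommMonoid M] (t : Finset ι) (f : ι → M) :
    ∏ i ∈ t, f i = ∏ k : Fin t.card, f (t.equivFin.symm k) := by
  rw [← Finset.prod_coe_sort t f]
  exact Fintype.prod_equiv t.equivFin _ _ fun i => by simp

/-! ### Abstract measure-theoretic bookkeeping -/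

/-- A product of finitely many measurable real functions bounded by `C ≥ 0`, times another such product, is
integrable (as a complex function) for a finite measure. [folklore] -/
theorem csclConv_integrable_prod {Ω : Type*} [MeasurableSpace Ω] (μ : Measure Ω) [IsFiniteMeasure μ]
    {ι κ : Type*} (t : Finset ι) (s : Finset κ) (f : ι → Ω → ℝ) (g : κ → Ω → ℝ) {C : ℝ} (hC : 0 ≤ C)
    (hf : ∀ i, Measurable (f i)) (hg : ∀ k, Measurable (g k)) (hfC : ∀ i ω, |f i ω| ≤ C)
    (hgC : ∀ k ω, |g k ω| ≤ C) :
    Integrable (fun ω => (((∏ i ∈ t, f i ω) * ∏ k ∈ s, g k ω : ℝ) : ℂ)) μ := by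
  refine (Integrable.of_bound
    ((Finset.measurable_prod t fun i _ => hf i).mul (Finset.measurable_prod s fun k _ => hg k)).aestronglyMeasurable
    (C ^ t.card * C ^ s.card) (Eventually.of_forall fun ω => ?_)).ofReal
  change ‖(∏ i ∈ t, f i ω) * ∏ k ∈ s, g k ω‖ ≤ _
  rw [norm_mul, norm_prod, norm_prod]
  refine mul_le_mul ?_ ?_ (Finset.prod_nonneg fun _ _ => norm_nonneg _) (pow_nonneg hC _)
  · exact (Finset.prod_le_prod (fun _ _ => norm_nonneg _) fun i _ =>
      (Real.norm_eq_abs _).trans_le (hfC i ω)).trans_eq (Finset.prod_const C)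
  · exact (Finset.prod_le_prod (fun _ _ => norm_nonneg _) fun k _ =>
      (Real.norm_eq_abs _).trans_le (hgC k ω)).trans_eq (Finset.prod_const C)

/-- Finite complex combinations of integrable sequences with convergent integrals are integrable with convergent
integrals (along a sequence of measure spaces). [folklore] -/
theorem csclConv_tendsto_sum {Ω : ℕ → Type*} [∀ j, MeasurableSpace (Ω j)] (μ : ∀ j, Measure (Ω j))
    {K : Type*} [Fintype K] (c : K → ℂ) (f : K → ∀ j, Ω j → ℂ)
    (hint : ∀ k j, Integrable (f k j) (μ j))
    (hlim : ∀ k, ∃ l : ℂ, Tendsto (fun j => ∫ ω, f k j ω ∂μ j) atTop (𝓝 l)) :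
    (∀ j, Integrable (fun ω => ∑ k, c k * f k j ω) (μ j)) ∧
      ∃ l : ℂ, Tendsto (fun j => ∫ ω, ∑ k, c k * f k j ω ∂μ j) atTop (𝓝 l) := by
  refine ⟨fun j => integrable_finsetSum _ fun k _ => (hint k j).const_mul (c k), ?_⟩
  choose l hl using hlim
  refine ⟨∑ k, c k * l k, ?_⟩
  have h : ∀ j, ∫ ω, ∑ k, c k * f k j ω ∂μ j = ∑ k, c k * ∫ ω, f k j ω ∂μ j := fun j => by
    rw [integral_finsetSum _ fun k _ => (hint k j).const_mul (c k)]
    simp only [integral_const_mul]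
  simp_rw [h]
  exact tendsto_finsetSum _ fun k _ => (hl k).const_mul (c k)

/-- **Raw monomials over finsets.** If all mixed `Fin`-indexed monomials of two uniformly bounded measurable families
`QA, QB` have convergent integrals, so do the finset-indexed ones (re-index over `Fin |t|`), and they are integrable.
[folklore] -/
theorem csclConv_monomial {Ω : ℕ → Type*} [∀ j, MeasurableSpace (Ω j)] (μ : ∀ j, Measure (Ω j))
    (hμ : ∀ j, IsFiniteMeasure (μ j)) {𝔖 : Type*} (QA QB : 𝔖 → ∀ j, Ω j → ℝ) {C : ℝ} (hC : 0 ≤ C)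
    (hAm : ∀ s j, Measurable (QA s j)) (hBm : ∀ s j, Measurable (QB s j))
    (hAb : ∀ s j ω, |QA s j ω| ≤ C) (hBb : ∀ s j ω, |QB s j ω| ≤ C)
    (H : ∀ (p q : ℕ) (u : Fin p → 𝔖) (v : Fin q → 𝔖), ∃ l : ℝ,
      Tendsto (fun j => ∫ ω, (∏ i, QA (u i) j ω) * ∏ i, QB (v i) j ω ∂μ j) atTop (𝓝 l))
    {ι κ : Type*} (t : Finset ι) (s : Finset κ) (u : ι → 𝔖) (v : κ → 𝔖) :
    (∀ j, Integrable (fun ω => (((∏ i ∈ t, QA (u i) j ω) * ∏ i ∈ s, QB (v i) j ω : ℝ) : ℂ)) (μ j)) ∧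
      ∃ l : ℂ, Tendsto (fun j => ∫ ω, (((∏ i ∈ t, QA (u i) j ω) * ∏ i ∈ s, QB (v i) j ω : ℝ) : ℂ) ∂μ j)
        atTop (𝓝 l) := by
  refine ⟨fun j => ?_, ?_⟩
  · haveI := hμ j
    exact csclConv_integrable_prod (μ j) t s (fun i => QA (u i) j) (fun i => QB (v i) j) hC
      (fun i => hAm _ _) (fun i => hBm _ _) (fun i ω => hAb _ _ _) (fun i ω => hBb _ _ _)
  · obtain ⟨l, hl⟩ := H t.card s.card (fun k => u (t.equivFin.symm k)) (fun k => v (s.equivFin.symm k))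
    refine ⟨(l : ℂ), ?_⟩
    have key : ∀ j (ω : Ω j), (∏ i ∈ t, QA (u i) j ω) * ∏ i ∈ s, QB (v i) j ω =
        (∏ k : Fin t.card, QA (u (t.equivFin.symm k)) j ω) *
          ∏ k : Fin s.card, QB (v (s.equivFin.symm k)) j ω := fun j ω => by
      rw [csclConv_prod_eq_prod_fin t (fun i => QA (u i) j ω), csclConv_prod_eq_prod_fin s (fun i => QB (v i) j ω)]
    simp_rw [key, integral_complex_ofReal]
    exact hl.ofReal

/-- **Centred products.** Under the hypotheses of `csclConv_monomial`, the product of the two centred products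
`∏ᵢ (QA_{uᵢ} − m)`, `∏ᵢ (QB_{vᵢ} − m)` (cast to `ℂ`) is integrable with convergent integrals: expand both into
sub-monomials. [folklore] -/
theorem csclConv_centred {Ω : ℕ → Type*} [∀ j, MeasurableSpace (Ω j)] (μ : ∀ j, Measure (Ω j))
    (hμ : ∀ j, IsFiniteMeasure (μ j)) {𝔖 : Type*} (QA QB : 𝔖 → ∀ j, Ω j → ℝ) {C : ℝ} (hC : 0 ≤ C)
    (hAm : ∀ s j, Measurable (QA s j)) (hBm : ∀ s j, Measurable (QB s j))
    (hAb : ∀ s j ω, |QA s j ω| ≤ C) (hBb : ∀ s j ω, |QB s j ω| ≤ C)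
    (H : ∀ (p q : ℕ) (u : Fin p → 𝔖) (v : Fin q → 𝔖), ∃ l : ℝ,
      Tendsto (fun j => ∫ ω, (∏ i, QA (u i) j ω) * ∏ i, QB (v i) j ω ∂μ j) atTop (𝓝 l))
    {ι κ : Type*} [Fintype ι] [Fintype κ] (u : ι → 𝔖) (v : κ → 𝔖) (mc : ℝ) :
    (∀ j, Integrable (fun ω => (∏ i, ((QA (u i) j ω - mc : ℝ) : ℂ)) * ∏ i, ((QB (v i) j ω - mc : ℝ) : ℂ)) (μ j)) ∧
      ∃ l : ℂ, Tendsto (fun j => ∫ ω, (∏ i, ((QA (u i) j ω - mc : ℝ) : ℂ)) * ∏ i, ((QB (v i) j ω - mc : ℝ) : ℂ) ∂μ j)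
        atTop (𝓝 l) := by
  classical
  have hpt : ∀ j (ω : Ω j), (∏ i, ((QA (u i) j ω - mc : ℝ) : ℂ)) * ∏ i, ((QB (v i) j ω - mc : ℝ) : ℂ) =
      ∑ p : Finset ι × Finset κ, ((∏ _i ∈ p.1ᶜ, (-(mc : ℂ))) * ∏ _i ∈ p.2ᶜ, (-(mc : ℂ))) *
        (((∏ i ∈ p.1, QA (u i) j ω) * ∏ i ∈ p.2, QB (v i) j ω : ℝ) : ℂ) := by
    intro j ω
    simp only [Complex.ofReal_sub]
    rw [csclConv_prod_sub_const, csclConv_prod_sub_const, Fintype.sum_mul_sum, Fintype.sum_prod_type]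
    refine Finset.sum_congr rfl fun t _ => Finset.sum_congr rfl fun s _ => ?_
    simp only [Complex.ofReal_mul, Complex.ofReal_prod]
    ring
  simp_rw [hpt]
  have hM := fun p : Finset ι × Finset κ => csclConv_monomial μ hμ QA QB hC hAm hBm hAb hBb H p.1 p.2 u v
  exact csclConv_tendsto_sum μ (fun p : Finset ι × Finset κ => (∏ _i ∈ p.1ᶜ, (-(mc : ℂ))) * ∏ _i ∈ p.2ᶜ, (-(mc : ℂ)))
    (fun (p : Finset ι × Finset κ) j ω => (((∏ i ∈ p.1, QA (u i) j ω) * ∏ i ∈ p.2, QB (v i) j ω : ℝ) : ℂ))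
    (fun p j => (hM p).1 j) (fun p => (hM p).2)

/-- **Pairings of representatives (abstract form).** Under the hypotheses of `csclConv_monomial`, the integral of
`conj (∑ₖ cₖ ∏ᵢ (QA_{x k i} − m)) · (∑ₖ c'ₖ ∏ᵢ (QB_{y k i} − m))` converges. [folklore] -/
theorem csclConv_pairing {Ω : ℕ → Type*} [∀ j, MeasurableSpace (Ω j)] (μ : ∀ j, Measure (Ω j))
    (hμ : ∀ j, IsFiniteMeasure (μ j)) {𝔖 : Type*} (QA QB : 𝔖 → ∀ j, Ω j → ℝ) {C : ℝ} (hC : 0 ≤ C)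
    (hAm : ∀ s j, Measurable (QA s j)) (hBm : ∀ s j, Measurable (QB s j))
    (hAb : ∀ s j ω, |QA s j ω| ≤ C) (hBb : ∀ s j ω, |QB s j ω| ≤ C)
    (H : ∀ (p q : ℕ) (u : Fin p → 𝔖) (v : Fin q → 𝔖), ∃ l : ℝ,
      Tendsto (fun j => ∫ ω, (∏ i, QA (u i) j ω) * ∏ i, QB (v i) j ω ∂μ j) atTop (𝓝 l))
    {K K' ι κ : Type*} [Fintype K] [Fintype K'] [Fintype ι] [Fintype κ]
    (c : K → ℂ) (c' : K' → ℂ) (x : K → ι → 𝔖) (y : K' → κ → 𝔖) (mc : ℝ) :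
    ∃ l : ℂ, Tendsto (fun j => ∫ ω, (starRingEnd ℂ) (∑ k, c k * ∏ i, ((QA (x k i) j ω - mc : ℝ) : ℂ)) *
      (∑ k, c' k * ∏ i, ((QB (y k i) j ω - mc : ℝ) : ℂ)) ∂μ j) atTop (𝓝 l) := by
  have hpt : ∀ j (ω : Ω j), (starRingEnd ℂ) (∑ k, c k * ∏ i, ((QA (x k i) j ω - mc : ℝ) : ℂ)) *
      (∑ k, c' k * ∏ i, ((QB (y k i) j ω - mc : ℝ) : ℂ)) =
      ∑ p : K × K', ((starRingEnd ℂ) (c p.1) * c' p.2) *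
        ((∏ i, ((QA (x p.1 i) j ω - mc : ℝ) : ℂ)) * ∏ i, ((QB (y p.2 i) j ω - mc : ℝ) : ℂ)) := by
    intro j ω
    simp only [map_sum, map_mul, map_prod, Complex.conj_ofReal]
    rw [Fintype.sum_mul_sum, Fintype.sum_prod_type]
    refine Finset.sum_congr rfl fun k _ => Finset.sum_congr rfl fun k' _ => ?_
    ring
  simp_rw [hpt]
  have hD := fun p : K × K' => csclConv_centred μ hμ QA QB hC hAm hBm hAb hBb H (x p.1) (y p.2) mc
  exact (csclConv_tendsto_sum μ (fun p : K × K' => (starRingEnd ℂ) (c p.1) * c' p.2)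
    (fun (p : K × K') j ω => (∏ i, ((QA (x p.1 i) j ω - mc : ℝ) : ℂ)) * ∏ i, ((QB (y p.2 i) j ω - mc : ℝ) : ℂ))
    (fun p j => (hD p).1 j) (fun p => (hD p).2)).2

/-- **Means of representatives (abstract form).** Under the hypotheses of `csclConv_monomial`, the integral of
`∑ₖ cₖ ∏ᵢ (QB_{y k i} − m)` converges (the case of an empty `QA`-string). [folklore] -/
theorem csclConv_mean {Ω : ℕ → Type*} [∀ j, MeasurableSpace (Ω j)] (μ : ∀ j, Measure (Ω j))
    (hμ : ∀ j, IsFiniteMeasure (μ j)) {𝔖 : Type*} (QA QB : 𝔖 → ∀ j, Ω j → ℝ) {C : ℝ} (hC : 0 ≤ C)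
    (hAm : ∀ s j, Measurable (QA s j)) (hBm : ∀ s j, Measurable (QB s j))
    (hAb : ∀ s j ω, |QA s j ω| ≤ C) (hBb : ∀ s j ω, |QB s j ω| ≤ C)
    (H : ∀ (p q : ℕ) (u : Fin p → 𝔖) (v : Fin q → 𝔖), ∃ l : ℝ,
      Tendsto (fun j => ∫ ω, (∏ i, QA (u i) j ω) * ∏ i, QB (v i) j ω ∂μ j) atTop (𝓝 l))
    {K κ : Type*} [Fintype K] [Fintype κ] (c : K → ℂ) (y : K → κ → 𝔖) (mc : ℝ) :
    ∃ l : ℂ, Tendsto (fun j => ∫ ω, ∑ k, c k * ∏ i, ((QB (y k i) j ω - mc : ℝ) : ℂ) ∂μ j) atTop (𝓝 l) := by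
  have hD := fun k : K => csclConv_centred μ hμ QA QB hC hAm hBm hAb hBb H (fun i : Fin 0 => (Fin.elim0 i : 𝔖)) (y k) mc
  simp only [Finset.univ_eq_empty, Finset.prod_empty, one_mul] at hD
  exact (csclConv_tendsto_sum μ c (fun (k : K) j ω => ∏ i, ((QB (y k i) j ω - mc : ℝ) : ℂ))
    (fun k j => (hD k).1 j) (fun k => (hD k).2)).2

/-! ### The registered stub -/

/-- `stub_csclConv` — **convergence of the pairings (and means) of lattice representatives from the raw monomial
data.** If along the odd torus sides `2 Sq j + 1` every raw monomial pairing
`∫ (∏ᵢ P(θ_{uᵢ} Θ Ũ)) (∏ᵢ P(θ_{vᵢ} τ^σ Ũ)) dμ` (`P = r.curvature.F`, `Θ = cfgReflect`, `τ^σ = configShift (−σe₀)`)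
converges, then for all test functions `F, G'` the pairing `∫ conj 𝔛_F(Θ Ũ) · 𝔛_{G'}(τ^σ Ũ) dμ` and the mean
`∫ 𝔛_F(Ũ) dμ` of their lattice representatives `𝔛_F(V) = ∑ₓ F(a x) ∏ᵢ (P(θ_{xᵢ} V) − m)` converge: the
representatives are finite complex combinations of raw monomials (`csclConv_pairing`, `csclConv_mean`; for the mean
use the empty `Θ`-string and `σ = 0`, `configShift (−0·e₀) = id`). [folklore] -/
theorem stub_csclConv :
    ∀ (G : Type) [Group G] [TopologicalSpace G] [IsTopologicalGroup G] [CompactSpace G]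
      [MeasurableSpace G] [BorelSpace G] (r : LatticeRep G) (β : ℝ) (Sq : ℕ → ℕ),
      (∀ (p q : ℕ) (u : Fin p → Site 4) (v : Fin q → Site 4) (σ : ℕ), ∃ l : ℝ,
        Tendsto (fun j : ℕ => ∫ U : GaugeConfig 4 (2 * Sq j + 1) G,
          (∏ i : Fin p, r.curvature.F (configShift (-(u i)) (cfgReflect (torusLift (2 * Sq j + 1) U)))) *
            (∏ i : Fin q, r.curvature.F (configShift (-(v i)) (configShift (-(Pi.single 0 ((σ : ℕ) : ℤ))) (torusLift (2 * Sq j + 1) U))))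
          ∂(wilsonMeasure r.ρ β)) atTop (𝓝 l)) →
      ∀ (n m L : ℕ) (a mc : ℝ) (F : SchwartzMap (Fin n → EuclideanSpace ℝ (Fin 4)) ℂ)
        (G' : SchwartzMap (Fin m → EuclideanSpace ℝ (Fin 4)) ℂ) (σ : ℕ),
        (∃ l : ℂ, Tendsto (fun j : ℕ => ∫ U : GaugeConfig 4 (2 * Sq j + 1) G, (starRingEnd ℂ) ((fun V : LGConfig 4 G => ∑ x : Fin n → ↥(box 4 L), F (fun i => a • siteToE (↑(x i) : Site 4)) * ∏ i, ((r.curvature.F (configShift (-(↑(x i) : Site 4)) V) - mc : ℝ) : ℂ)) (cfgReflect (torusLift (2 * Sq j + 1) U))) * (fun V : LGConfig 4 G => ∑ x : Fin m → ↥(box 4 L), G' (fun i => a • siteToE (↑(x i) : Site 4)) * ∏ i, ((r.curvature.F (configShift (-(↑(x i) : Site 4)) V) - mc : ℝ) : ℂ)) (configShift (-(Pi.single 0 ((σ : ℕ) : ℤ))) (torusLift (2 * Sq j + 1) U)) ∂(wilsonMeasure r.ρ β)) atTop (𝓝 l)) ∧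
        (∃ l : ℂ, Tendsto (fun j : ℕ => ∫ U : GaugeConfig 4 (2 * Sq j + 1) G, (fun V : LGConfig 4 G => ∑ x : Fin n → ↥(box 4 L), F (fun i => a • siteToE (↑(x i) : Site 4)) * ∏ i, ((r.curvature.F (configShift (-(↑(x i) : Site 4)) V) - mc : ℝ) : ℂ)) (torusLift (2 * Sq j + 1) U) ∂(wilsonMeasure r.ρ β)) atTop (𝓝 l)) := by
  intro G _ _ _ _ _ _ r β Sq H n m L a mc F G' σ
  obtain ⟨C, hC⟩ := r.curvature.bounded
  have hC0 : 0 ≤ C := (abs_nonneg _).trans (hC fun _ => 1)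
  have hμ : ∀ j : ℕ, IsFiniteMeasure (wilsonMeasure (d := 4) (L := 2 * Sq j + 1) r.ρ β) := fun j => by
    haveI := isProbabilityMeasure_wilsonMeasure (d := 4) (L := 2 * Sq j + 1) r.ρ r.continuous β
    infer_instance
  -- measurability of the three kinds of shifted factors read on the lift
  have hmA : ∀ (s : Site 4) (j : ℕ), Measurable fun U : GaugeConfig 4 (2 * Sq j + 1) G =>
      r.curvature.F (Literature.MathematicalPhysics.QuantumLattice.configShift (-s) (cfgReflect (torusLift (2 * Sq j + 1) U))) := fun s j =>
    r.curvature.measurable.comp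
      ((Literature.MathematicalPhysics.QuantumLattice.configShift _).measurable.comp (measurable_cfgReflect.comp (measurable_torusLift _)))
  have hmB : ∀ (s : Site 4) (j : ℕ), Measurable fun U : GaugeConfig 4 (2 * Sq j + 1) G =>
      r.curvature.F (Literature.MathematicalPhysics.QuantumLattice.configShift (-s) (Literature.MathematicalPhysics.QuantumLattice.configShift (-(Pi.single 0 ((σ : ℕ) : ℤ))) (torusLift (2 * Sq j + 1) U))) :=
    fun s j => r.curvature.measurable.comp
      ((Literature.MathematicalPhysics.QuantumLattice.configShift _).measurable.comp ((Literature.MathematicalPhysics.QuantumLattice.configShift _).measurable.comp (measurable_torusLift _)))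
  have hmB' : ∀ (s : Site 4) (j : ℕ), Measurable fun U : GaugeConfig 4 (2 * Sq j + 1) G =>
      r.curvature.F (Literature.MathematicalPhysics.QuantumLattice.configShift (-s) (torusLift (2 * Sq j + 1) U)) := fun s j =>
    r.curvature.measurable.comp ((Literature.MathematicalPhysics.QuantumLattice.configShift _).measurable.comp (measurable_torusLift _))
  refine ⟨?_, ?_⟩
  · exact csclConv_pairing (Ω := fun j => GaugeConfig 4 (2 * Sq j + 1) G)
      (fun j => wilsonMeasure (d := 4) (L := 2 * Sq j + 1) r.ρ β) hμ
      (fun (s : Site 4) j U => r.curvature.F (Literature.MathematicalPhysics.QuantumLattice.configShift (-s) (cfgReflect (torusLift (2 * Sq j + 1) U))))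
      (fun (s : Site 4) j U => r.curvature.F
        (Literature.MathematicalPhysics.QuantumLattice.configShift (-s) (Literature.MathematicalPhysics.QuantumLattice.configShift (-(Pi.single 0 ((σ : ℕ) : ℤ))) (torusLift (2 * Sq j + 1) U))))
      hC0 hmA hmB (fun _ _ _ => hC _) (fun _ _ _ => hC _) (fun p q u v => H p q u v σ)
      (fun x : Fin n → ↥(box 4 L) => F (fun i => a • siteToE (↑(x i) : Site 4)))
      (fun x : Fin m → ↥(box 4 L) => G' (fun i => a • siteToE (↑(x i) : Site 4)))
      (fun (x : Fin n → ↥(box 4 L)) i => (↑(x i) : Site 4)) (fun (x : Fin m → ↥(box 4 L)) i => (↑(x i) : Site 4)) mc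
  · -- the mean: empty `Θ`-string and `σ = 0` (`configShift (-(0 • e₀)) = id`)
    have h0 : ∀ W : LGConfig 4 G, Literature.MathematicalPhysics.QuantumLattice.configShift (-(Pi.single 0 ((0 : ℕ) : ℤ)) : Site 4) W = W := fun W => by
      funext e
      simp [Literature.MathematicalPhysics.QuantumLattice.configShift_apply]
    have H0 : ∀ (p q : ℕ) (u : Fin p → Site 4) (v : Fin q → Site 4), ∃ l : ℝ,
        Tendsto (fun j : ℕ => ∫ U : GaugeConfig 4 (2 * Sq j + 1) G,
          (∏ i : Fin p, r.curvature.F (Literature.MathematicalPhysics.QuantumLattice.configShift (-(u i)) (cfgReflect (torusLift (2 * Sq j + 1) U)))) *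
            (∏ i : Fin q, r.curvature.F (Literature.MathematicalPhysics.QuantumLattice.configShift (-(v i)) (torusLift (2 * Sq j + 1) U)))
          ∂(wilsonMeasure r.ρ β)) atTop (𝓝 l) := fun p q u v => by
      simpa only [h0] using H p q u v 0
    exact csclConv_mean (Ω := fun j => GaugeConfig 4 (2 * Sq j + 1) G)
      (fun j => wilsonMeasure (d := 4) (L := 2 * Sq j + 1) r.ρ β) hμ
      (fun (s : Site 4) j U => r.curvature.F (Literature.MathematicalPhysics.QuantumLattice.configShift (-s) (cfgReflect (torusLift (2 * Sq j + 1) U))))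
      (fun (s : Site 4) j U => r.curvature.F (Literature.MathematicalPhysics.QuantumLattice.configShift (-s) (torusLift (2 * Sq j + 1) U)))
      hC0 hmA hmB' (fun _ _ _ => hC _) (fun _ _ _ => hC _) H0
      (fun x : Fin n → ↥(box 4 L) => F (fun i => a • siteToE (↑(x i) : Site 4)))
      (fun (x : Fin n → ↥(box 4 L)) i => (↑(x i) : Site 4)) mc

end Summit.QuantumFields.YangMills.Theorems.ContinuumLegGivenGap

end
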